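import Summits.Ventures.CertifiedArithmetic.LowPrec.EnvelopeStructural
import Summits.Ventures.CertifiedArithmetic.LowPrec.EnvelopesE2M1
import Summits.Ventures.CertifiedArithmetic.LowPrec.Exact
import Summits.Ventures.CertifiedArithmetic.LowPrec.Accumulate
import Summits.Ventures.CertifiedArithmetic.LowPrec.AccumulateTree
import Summits.Ventures.CertifiedArithmetic.LowPrec.SRBridge
import Summits.Ventures.CertifiedArithmetic.LowPrec.SRAccumulation
import Summits.Ventures.CertifiedArithmetic.LowPrec.OptScaleNesting
import Summits.Ventures.CertifiedArithmetic.LowPrec.OptSRMinVariance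
import Summits.Ventures.CertifiedArithmetic.LowPrec.OptTwoCandidates
import Summits.Ventures.CertifiedArithmetic.LowPrec.OptSearchGainSSE
import Summits.Ventures.CertifiedArithmetic.LowPrec.OptInt8Minimax
import Summits.Ventures.CertifiedArithmetic.LowPrec.CompensatedSum
import Summits.Ventures.CertifiedArithmetic.LowPrec.AccumulateDirected
import Summits.Ventures.CertifiedArithmetic.LowPrec.OptTreeChain

/-!
# Venture statement — CertifiedArithmetic / lowprec (cell `pub-lowprec`)

The text between the rules below is `VENTURE-STATEMENT.md` v1 VERBATIM (lead draft 2026-08-19T20:10Z,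
referee sign-off 2026-08-19T20:35Z), as required for the venture's statement file. After it, the
namespace `Summit.Ventures.CertifiedArithmetic` states the theorem-shaped rung targets R1–R3 as
`Prop`s over the landed Lean substrate (`Literature/ComputerArithmetic/FloatingPoint/*`,
`Summits/Ventures/CertifiedArithmetic/LowPrec/*`); each docstring names the landed declaration that
proves it (or says OPEN). R4 (optimal schemes, opt seat) and the accumulation-level SR statements
beyond `R3_SRSumUnbiased` are appended by their seats (file is append-only). Nothing here is a
`True`/vacuous definition: every Prop quantifies over all data of the named formats.

---
# VENTURE STATEMENT — CertifiedArithmetic / lowprec (DRAFT v1 by the lead seat `pub-lowprec-enum`, 2026-08-19T20:10Z; referee `pub-lowprec-ref` reviews; then committed as lean/Summits/Ventures/CertifiedArithmetic/STATEMENT.md with a typed `Statement.lean` stub)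

HONEST FRAMING (verbatim, page 1 of every file): certified error envelopes and provably optimal rounding/accumulation
schemes for low-precision formats under stated cost models; every table by two implementations; no hardware or vendor claims.

## Target (one paragraph)
For the named low-precision binary floating-point formats — OCP FP8 E4M3/E5M2 (OFP8 rev 1.0), the FNUZ variants, IEEE-P3109
`binary8p{3,4,5}` (interim report v3.2.1, signed, extended/finite domains), OCP FP6 E3M2/E2M3, FP4 E2M1, and the OCP MX v1.0
block-scaled containers (E8M0 shared scale, k = 32) — produce (R1) EXHAUSTIVE exact-rational error tables and envelopes for
{×,+} over all representable pairs into every result/accumulator format {same, binary16, bfloat16, binary32} under every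
rounding mode {RNE, RZ, RU, RD, SR-as-distribution} and every overflow convention the specs name, each table produced by TWO
independent implementations with a full-table diff of 0; (R2) PROVED worst-case and distributional error bounds for
mixed-precision GEMM (fp8×fp8 products, fp16/bf16/fp32 accumulators, sequential/pairwise/blocked/compensated orders,
block-scaled inputs) with the worst-case witnesses exhibited and small-n bounds verified exhaustively/SMT; (R3) unbiasedness
and variance theorems for stochastic rounding in these formats and accumulations (published Connolly–Higham–Mary-class
results typed verbatim as named facts; ours proved where new); (R4) rounding/accumulation/scale-selection schemes that are
PROVABLY OPTIMAL under STATED cost models (accumulator width, extra-operation budget, block size under a stated input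
distribution), with optimality proofs or exhaustive certificates; and (R5, Lean) kernel-checkable format definitions with
exact rational semantics, decode/encode/round functions, `decide`-checked small tables and the R2/R3 bounds as theorems under
lean/Summits/Ventures/CertifiedArithmetic/ (published results typed verbatim under lean/Literature/ComputerArithmetic/<AuthorYear>/).

## Ladder / rungs
- R1 (envelopes certified): FORMATS.md conventions quoted from the specs; impl A (exact rational, value-set semantics) and
  impl B (independent bit-level integer pipeline) agree on 100 % of every table; ENVELOPES.md per (format pair, op, result
  format, mode, overflow convention): max abs/rel error per exponent band, ulp histograms, exactness counts, overflow/
  saturation/NaN counts, SR bias/variance envelopes, and every anomaly recorded exactly. Status: in progress (enum seat).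
- R2 (GEMM bounds): theorem-form worst-case bounds (Higham γ_n made exact for these formats incl. underflow/overflow
  regimes à la Mary–Mikaitis 2025) + adversarial witnesses attaining/approaching them; exhaustive/SMT verification at small n;
  distributional bounds under stated input models. (gemm seat)
- R3 (SR theorems): unbiasedness / variance / martingale-concentration statements for SR in these formats typed from the
  literature (Connolly–Higham–Mary 2021; El Arar et al. 2023–2025; limited-precision SR) and the format-specific constants
  certified exhaustively. (sr seat)
- R4 (optimal schemes): for each stated cost model, the optimal scheme and its certificate (exhaustive over the finite design
  space, or a proof). (opt seat)
- R5 (Lean): format types, exact semantics, round functions, `decide` tables, bounds as theorems; positioned against FLoPS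
  (Chang–Park–Lim–Nagarakatte 2026, P3109 in Lean) and FloatSpec (Flocq port) — we cite, do not duplicate: our Lean covers the
  OCP formats, the exhaustive op tables as kernel certificates, and the accumulation bounds. (lean seat)

## Grade target
Referee-grade CERTIFICATE bundle (class A venture cell): every number in the paper regenerable by two programs that agree
bit-for-bit, every bound a theorem (Lean where feasible, else a proof in the text plus an exhaustive/SMT certificate at small
sizes), every published input typed verbatim with its citation tag. Placement: a computer-arithmetic venue (ARITH / ACM TOMS /
SISC software section) as "certified reference tables + proved accumulation bounds for OCP/P3109 8/6/4-bit formats".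

## Why this is not one of the 21 summits
It is finite, decidable engineering mathematics: every statement is about explicitly enumerable value sets (≤ 2^16 pairs per
table) or about rounding-error bounds whose proofs are classical (Wilkinson/Higham model) once the format constants are
fixed; there is no open conjecture of summit character, and nothing here bears on any summit's Statement. Its value is a
theorem / certificate / typed skeleton / precise negative result (e.g. "no k-operation compensated scheme beats X under cost
model M"), stated as such in every DONE line; it never counts toward summit-bearing accounting (human directive 2026-08-19).

## Freshness position (lead, 2026-08-19; details in FRESHNESS.md)
Nearest prior art found so far: FLoPS arXiv:2602.15965 (P3109 formal model in Lean 4/Mathlib, FastTwoSum/ExtractScalar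
properties; no OCP formats, no exhaustive error tables, no GEMM bounds); Mary–Mikaitis SISC 2025 doi:10.1137/24m1685109
(narrow-range matmul error analysis with scaling; analytic, not exhaustive/certified); El Arar–Fasi–Filip–Mikaitis SR survey
arXiv:2603.06060 (2026) and limited-precision SR SISC 2025 doi:10.1137/24m1681458; Micikevicius et al. arXiv:2209.05433 and
Rouhani et al. arXiv:2310.10537 (format definitions). Claimed-in-print items make us certification/comparison at audit size;
announced-unrefereed items we referee.

## Referee sign-off (R-v)

Signed: referee seat pub-lowprec-ref (gen 2), 2026-08-19T20:35Z.
Basis: Target is theorem-shaped (formats × ops × result formats × modes × overflow conventions, each rung with its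
closing artefact); grade target names the venue class and defines "certified" (two independent implementations with
full-table DIFF + kernel check where feasible); why-not-a-summit is honest (finite/decidable engineering mathematics,
never summit-bearing); the framing line is verbatim on page 1. The P3109 "interim report v3.2.1" version pin is real —
verified against the FLoPS reference list [corpus:paper:arxiv-2602.15965 p.17]; note FLoPS p.14 reports errata in that
report for UNSIGNED formats (emax, infinity code) — quote the signed-format rules by page in FORMATS.md.
Conditions tracked in REFEREE.md Round 1 (RETURN-1: FORMATS.md still empty; RETURN-2/3: opt cert hygiene + cost-model
writeup) — they gate the word "certified" on specific artefacts, not this statement. Fit for commit as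
lean/Summits/Ventures/CertifiedArithmetic/STATEMENT.md with the typed Statement.lean stub beside it.
---
-/

namespace Summit.Ventures.CertifiedArithmetic

open Literature.ComputerArithmetic.FloatingPoint
open Literature.ComputerArithmetic.FloatingPoint.MiniFloat
open Literature.ComputerArithmetic.FloatingPoint.Format

/-! ### R1 — envelopes -/

/-- R1 (structural absolute envelope, every format): for every rational in range, the RNE
rounding error is at most half the spacing of the binade of the ROUNDED result:
`|x| ≤ maxRat φ → |x - fl x| ≤ ½·2^(E-1)·quantum φ`, `E = expCode (roundNE φ x)`.
PROVED: `MiniFloat.abs_sub_roundNE_le_half_ulp_result` (EnvelopeStructural.lean). -/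
def R1_AbsEnvelope (φ : Format) : Prop :=
  ∀ x : ℚ, |x| ≤ φ.maxRat →
    |x - (roundNE φ x).toRat| ≤ 2 ^ ((roundNE φ x).expCode - 1) / 2 * φ.quantum

/-- R1 (structural sharp relative envelope, every format): in the normal range
`2^m·quantum ≤ |x| ≤ maxRat`, `|x - fl x| ≤ u/(1+u)·|x|`.
PROVED: `MiniFloat.abs_sub_roundNE_le_sharp` (EnvelopeStructural.lean). -/
def R1_RelEnvelope (φ : Format) : Prop :=
  ∀ x : ℚ, 2 ^ φ.manBits * φ.quantum ≤ |x| → |x| ≤ φ.maxRat →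
    |x - (roundNE φ x).toRat| ≤ φ.unitRoundoff / (1 + φ.unitRoundoff) * |x|

/-- R1 (exhaustive table envelope, per format and operation, RNE): every in-range ordered pair
has product error within `envMul[E]` and sum error within `envAdd[E]` (`E` = exponent code of
the rounded result), and the sum's relative error is at most `cAdd · |a+b|`. For
`φ = E2M1` with `envMul = [¼,¼,¼,½]`, `envAdd = [0,0,½,1]`, `cAdd = 1/5`: PROVED by `decide +kernel`
(EnvelopesE2M1.lean: `E2M1_mul_abs_envelope`, `E2M1_add_abs_envelope`, `E2M1_add_rel_envelope`);
likewise `E3M2` (`[1/32,1/32,1/16,…,2]`, `1/9`) and `E2M3` (`[1/16,1/16,⅛,¼]`, `1/17`) in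
EnvelopesE3M2/E2M3.lean. FP8: OPEN as kernel enumerations (structural R1 above covers them). -/
def R1_TableEnvelope (φ : Format) (envMul envAdd : List ℚ) (cAdd : ℚ) : Prop :=
  (∀ a b : MiniFloat φ, |a.toRat * b.toRat| ≤ φ.maxRat →
      |errMul φ a b| ≤ envMul.getD (roundNE φ (a.toRat * b.toRat)).expCode 0) ∧
  (∀ a b : MiniFloat φ, |a.toRat + b.toRat| ≤ φ.maxRat →
      |errAdd φ a b| ≤ envAdd.getD (roundNE φ (a.toRat + b.toRat)).expCode 0) ∧
  (∀ a b : MiniFloat φ, |a.toRat + b.toRat| ≤ φ.maxRat → a.toRat + b.toRat ≠ 0 →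
      |errAdd φ a b| ≤ cAdd * |a.toRat + b.toRat|)

/-! ### R2 — GEMM / accumulation bounds -/

/-- R2 (product stage): every product of an `φ`-value and a `ψ`-value is a value of the
accumulator format `α` (so the product stage of a mixed-precision GEMM is error-free).
PROVED for (E4M3,E4M3), (E5M2,E5M2), (E4M3,E5M2) into bfloat16 and binary32, (E2M1,E2M1) into
E4M3, FP6 pairs into binary16 (Exact.lean); REFUTED with witnesses for (E4M3,E4M3) and
(E5M2,E5M2) into binary16 (`E4M3_mul_E4M3_not_exact_in_Binary16`, `E5M2_mul_E5M2_…`). -/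
def R2_ExactProducts (φ ψ α : Format) : Prop :=
  ∀ (a : MiniFloat φ) (b : MiniFloat ψ), ∃ z : MiniFloat α, z.toRat = a.toRat * b.toRat

/-- R2 (sequential accumulation, worst case): if the summands `x 0 … x n` are values of the
accumulator format `α` and no step of the recursive RNE accumulation leaves the finite range,
then `|ŝₙ - Σ xᵢ| ≤ ((1 + u_α)ⁿ - 1) · Σ |xᵢ|` (hence `≤ γₙ Σ|xᵢ|`): Higham's bound for the
bit-level accumulation, gradual underflow included.
PROVED: `MiniFloat.abs_seqSum_sub_sum_le` (Accumulate.lean), for every `α` with `emaxCode ≥ 2`.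
Sharper/other-order constants ((n-1)u/(1+u) any order, Jeannerod–Rump; ku/(1+ku), Lange–Rump;
pairwise/blocked/compensated) are the gemm seat's cited facts and certificates: OPEN in Lean. -/
def R2_SeqSumBound (α : Format) : Prop :=
  ∀ (x : ℕ → ℚ) (n : ℕ), (∀ i ≤ n, ∃ y : MiniFloat α, y.toRat = x i) → InRange α x n →
    |(seqSum α x n).toRat - ∑ i ∈ Finset.range (n + 1), x i|
      ≤ ((1 + α.unitRoundoff) ^ n - 1) * ∑ i ∈ Finset.range (n + 1), |x i|

/-! ### R3 — stochastic rounding -/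

/-- R3 (one rounding): stochastic rounding (mode 2, "SR-nearness") of a rational `x` in range
into `φ`, i.e. the two-point law on the values of `roundDown φ x`, `roundUp φ x` with
`P(up) = (x - ↓x)/(↑x - ↓x)`, has mean exactly `x` and variance `(x - ↓x)(↑x - x)`.
PROVED: `MiniFloat.srMean_format`, `MiniFloat.srVar_format` (SRBridge.lean, instantiating the
typed Connolly–Higham–Mary Lemma 4.4 / El Arar et al. identity over `valueSet φ`). -/
def R3_SROneStep (φ : Format) : Prop :=
  ∀ x : ℚ, |x| ≤ φ.maxRat →
    Literature.ComputerArithmetic.ConnollyHighamMary2021.probUp (valueSet φ) x * (roundUp φ x).toRat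
      + (1 - Literature.ComputerArithmetic.ConnollyHighamMary2021.probUp (valueSet φ) x)
        * (roundDown φ x).toRat = x ∧
    Literature.ComputerArithmetic.ConnollyHighamMary2021.srVar (valueSet φ) x
      = (x - (roundDown φ x).toRat) * ((roundUp φ x).toRat - x)

/-- R3 (recursive SR summation is unbiased absent saturation): for the value set of `φ`, the
outcome-tree expectation of the SR accumulation `ŝ₀ = s, ŝₖ₊₁ = SR(ŝₖ + xₖ)` equals `s + Σ xₖ`
whenever no branch saturates — the finite-format form of CHM21 Thm 4.13 (summation).
PROVED (sr seat): `Summit.Ventures.CertifiedArithmetic.LowPrec.SR.accExp_id_of_noSat`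
(SRAccumulation.lean), here instantiated with `F = valueSet φ`. -/
def R3_SRSumUnbiased (φ : Format) : Prop :=
  ∀ (x : ℕ → ℚ) (n : ℕ) (s : ℚ), LowPrec.SR.NoSat (valueSet φ) x n s →
    LowPrec.SR.accExp (valueSet φ) x n (fun t => t) s = s + ∑ k ∈ Finset.range n, x k

/-! ### R2 — any evaluation order (appended 2026-08-19T22:45Z) -/

/-- R2 (ANY evaluation order, sharp constant): for every binary evaluation tree (`SumTree` of the
typed Jeannerod–Rump file — sequential, pairwise, blocked, …) whose leaves are values of the
accumulator format `α` and whose every node's exact argument stays in range,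
`|ŝ - s| ≤ (n - 1)·u_α/(1 + u_α)·Σ|xᵢ|` — the Jeannerod–Rump 2018 Thm 4.1 constant, no restriction
on `n`, gradual underflow included. PROVED: `MiniFloat.abs_eval_sub_exact_le_sharp`
(AccumulateSharp.lean) for every `α` with `emaxCode ≥ 2`; the weaker height form
`((1+u)^h - 1)·Σ|xᵢ|` is `MiniFloat.abs_eval_sub_exact_le_height` (AccumulateTree.lean). -/
def R2_AnyOrderSharp (α : Format) : Prop :=
  ∀ t : Literature.ComputerArithmetic.JeannerodRump2018.SumTree, TreeInRange α t →
    |t.eval (flα α) - t.exact|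
      ≤ ((t.leaves.length : ℚ) - 1) * (α.unitRoundoff / (1 + α.unitRoundoff))
        * (t.leaves.map abs).sum

/-! ### R4 — optimal schemes (opt seat `pub-lowprec-opt`), part 1 — appended by the lean seat from HOME
`lean/opt/R4_StatementAppend.lean` (sha256 prefix `e4efa507`; Props verbatim). Cost models:
COST-MODELS.md; theorems and two-implementation certificates: OPTIMA.md (S1–S8'', S8-gain, §W) and
certs/opt/. Kernel-checked: the two engines below (Lemma S1/S2 scale halving, CM-R minimum variance;
`LowPrec/OptScaleNesting.lean`, `LowPrec/OptSRMinVariance.lean`) and Theorems S3 / S5 (L∞ and SSE) / S6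
(`LowPrec/OptTwoCandidates.lean` ff., whose `R4_…` Props follow in part 2 once those files land); the
remaining window / regret theorems (S4, S7–S8'', S8-gain) are CERTIFIED (exact rational certificates,
two implementations, 0-mismatch diffs) and OPEN in Lean. Discharges: `RungStatus.lean`. -/

/-- R4 (CM-S engine, E2M1): halving a shared scale never increases the element error below the lower
clip point and leaves it unchanged on the coincidence zone. In integer units where the scale-`t` grid is
`e2m1Hi = {0,2,4,6,8,12,16,24}` (`t = 4`) and the scale-`t/2` grid is `e2m1Lo = {0,1,2,3,4,6,8,12}`:
for `y ≤ 12 (= 3t)` the distance to `e2m1Lo` is at most the distance to `e2m1Hi`, with equality on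
`4 ≤ y ≤ 12`. This is Lemma S1/S2 of OPTIMA.md, the engine of the two-candidate window theorems S3/S4.
PROVED: `LowPrec.Opt.e2m1_halving_le`, `LowPrec.Opt.e2m1_halving_eq` (OptScaleNesting.lean; the E2M3 and
E3M2 versions `e2m3_halving_le/eq`, `e3m2_halving_le/eq` are proved there too). -/
def R4_ScaleHalvingE2M1 : Prop :=
  (∀ y : ℚ, y ≤ 12 →
    LowPrec.Opt.gridDist (LowPrec.Opt.castGrid LowPrec.Opt.e2m1Lo)
        (LowPrec.Opt.castGrid_nonempty ⟨0, by decide⟩) y ≤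
      LowPrec.Opt.gridDist (LowPrec.Opt.castGrid LowPrec.Opt.e2m1Hi)
        (LowPrec.Opt.castGrid_nonempty ⟨0, by decide⟩) y) ∧
  (∀ y : ℚ, 4 ≤ y → y ≤ 12 →
    LowPrec.Opt.gridDist (LowPrec.Opt.castGrid LowPrec.Opt.e2m1Hi)
        (LowPrec.Opt.castGrid_nonempty ⟨0, by decide⟩) y =
      LowPrec.Opt.gridDist (LowPrec.Opt.castGrid LowPrec.Opt.e2m1Lo)
        (LowPrec.Opt.castGrid_nonempty ⟨0, by decide⟩) y)

/-- R4 (CM-R: stochastic rounding is the minimum-variance unbiased rounding). For any finitely supported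
randomised rounding of `x` (weights `w i ≥ 0` summing to `1` on points `v i`) that is unbiased
(`Σ wᵢ vᵢ = x`) and uses only representable points, i.e. points outside the open gap `(a, b)` between
the two neighbours of `x`, the variance is at least `(x - a)(b - x)` — the variance of the two-point SR
rule, which is moreover the unique unbiased rule supported on `{a, b}`.
PROVED: `LowPrec.Opt.variance_lower_bound` (with `LowPrec.Opt.variance_strict_of_mass_outside` for
strictness and `LowPrec.Opt.sr_unbiased_two_point_unique`, `LowPrec.Opt.sr_two_point_variance`)
(OptSRMinVariance.lean). -/
def R4_SRMinVariance : Prop :=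
  ∀ (n : ℕ) (w v : Fin n → ℚ) (a b x : ℚ), a ≤ b → (∀ i, 0 ≤ w i) → ∑ i, w i = 1 →
    ∑ i, w i * v i = x → (∀ i, v i ≤ a ∨ b ≤ v i) → (x - a) * (b - x) ≤ ∑ i, w i * (v i - x) ^ 2

/-! ### R4 — optimal schemes, part 2 (opt seat `pub-lowprec-opt`): Theorems S3, S5 (L∞ and SSE), S6 of
OPTIMA.md as Props generic in the element grid `B` (top `T`), verbatim from HOME
`lean/opt/R4_TwoCandidates_StatementBlock.lean.txt` (sha256 prefix `5f40342f`); kernel-checked for the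
E2M1/E2M3/E3M2 grids in `LowPrec/OptTwoCandidates.lean` (S3, p198735), `OptCeilMinimax.lean` (S5 L∞,
S6-inf, p198987), `OptSearchGainSSE.lean` (S6 SSE, S5 SSE generic, p199433), `OptSSEInstances.lean`
(p199665) — the opt seat's development, landed by opt gen2; discharges `R4_…_holds` in
`RungStatus.lean`. -/

open LowPrec.Opt in
/-- R4 (CM-S, Theorem S3 of OPTIMA.md, power-of-two shared scales, L∞), generic in the element grid
`B` with top `T`: for every block of nonnegative rationals with maximum `a` and the scale parameter `s`
of the non-clipping candidate (`T s / 2 < a ≤ T s`), no coarser power-of-two scale has smaller L∞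
error and every scale `s/2^n`, `n ≥ 2`, has strictly larger L∞ error — so an optimal scale is `s` or
`s/2`. -/
def R4_TwoCandidates (B : Finset ℕ) (hB : B.Nonempty) (T : ℕ) : Prop :=
  ∀ (k : ℕ) (x : Fin k → ℚ) (s a : ℚ) (i₀ : Fin k), 0 < s → (∀ i, 0 ≤ x i) → (∀ i, x i ≤ a) →
    a ≤ (T : ℚ) * s → (T : ℚ) * s < 2 * a → x i₀ = a →
      (∀ n : ℕ, blockErr hB s x i₀ ≤ blockErr hB (2 ^ n * s) x i₀) ∧
      (∀ n : ℕ, 2 ≤ n → blockErr hB s x i₀ < blockErr hB (s / 2 ^ n) x i₀)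

open LowPrec.Opt in
/-- R4 (CM-S, Theorem S5 of OPTIMA.md, L∞ half): the non-clipping power-of-two scale `2u`
(`T u < a ≤ 2 T u`) is MINIMAX-optimal among all power-of-two scales `v` (coarser `2^n (2u)`, the half
`u`, finer `(2u)/2^n`, `n ≥ 2`): every block with maximum `a` is matched by a block with the same
maximum whose L∞ error at scale `v` is at least as large. -/
def R4_CeilMinimaxLinf (B : Finset ℕ) (hB : B.Nonempty) (T : ℕ) : Prop :=
  ∀ (k : ℕ) (x : Fin k → ℚ) (u a : ℚ) (i₀ : Fin k) (v : ℚ), 0 < u → (∀ i, 0 ≤ x i) → (∀ i, x i ≤ a) →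
    a ≤ (T : ℚ) * (2 * u) → (T : ℚ) * u < a → x i₀ = a →
    ((∃ n : ℕ, v = 2 ^ n * (2 * u)) ∨ v = u ∨ (∃ n : ℕ, 2 ≤ n ∧ v = 2 * u / 2 ^ n)) →
      ∃ x' : Fin k → ℚ, (∀ i, 0 ≤ x' i) ∧ (∀ i, x' i ≤ a) ∧ x' i₀ = a ∧
        blockErr hB (2 * u) x i₀ ≤ blockErr hB v x' i₀

open LowPrec.Opt in
/-- R4 (CM-S, Corollary S6-inf of OPTIMA.md): no power-of-two scale `v` beats the non-clipping scale `2u`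
(`T u < a ≤ 2 T u`) by more than `u` (= half the finest spacing of the non-clipping grid) in block L∞
error. -/
def R4_SearchGainLinf (B : Finset ℕ) (hB : B.Nonempty) (T : ℕ) : Prop :=
  ∀ (k : ℕ) (x : Fin k → ℚ) (u a : ℚ) (i₀ : Fin k) (v : ℚ), 0 < u → (∀ i, 0 ≤ x i) → (∀ i, x i ≤ a) →
    a ≤ (T : ℚ) * (2 * u) → (T : ℚ) * u < a → x i₀ = a →
    ((∃ n : ℕ, v = 2 ^ n * (2 * u)) ∨ v = u ∨ (∃ n : ℕ, 2 ≤ n ∧ v = 2 * u / 2 ^ n)) →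
      blockErr hB (2 * u) x i₀ ≤ blockErr hB v x i₀ + u

open LowPrec.Opt in
/-- R4 (CM-S, Theorem S6 of OPTIMA.md, O-2): no power-of-two scale `v` beats the non-clipping scale `2u`
(`T u < a ≤ 2 T u`) by more than `(k-1) u²` in block SSE (`u` = half the finest spacing of the
non-clipping grid; attained — certificate C5). -/
def R4_SearchGainSSE (B : Finset ℕ) (hB : B.Nonempty) (T : ℕ) : Prop :=
  ∀ (k : ℕ) (x : Fin k → ℚ) (u a : ℚ) (i₀ : Fin k) (v : ℚ), 0 < u → (∀ i, 0 ≤ x i) → (∀ i, x i ≤ a) →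
    a ≤ (T : ℚ) * (2 * u) → (T : ℚ) * u < a → x i₀ = a →
    ((∃ n : ℕ, v = 2 ^ n * (2 * u)) ∨ v = u ∨ (∃ n : ℕ, 2 ≤ n ∧ v = 2 * u / 2 ^ n)) →
      blockSSE hB (2 * u) x ≤ blockSSE hB v x + ((k : ℚ) - 1) * u ^ 2

open LowPrec.Opt in
/-- R4 (CM-S, Theorem S6 attainment): for every block size `k ≥ 1` and scale parameter `u > 0` there is a
block with maximum in `(T u, 2 T u]` whose SSE at the non-clipping scale `2u` exceeds its SSE at the half
scale `u` by exactly `(k-1) u²`. -/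
def R4_SearchGainSSE_attained (B : Finset ℕ) (hB : B.Nonempty) (T : ℕ) : Prop :=
  ∀ (k : ℕ), 1 ≤ k → ∀ (u : ℚ), 0 < u →
    ∃ (x : Fin k → ℚ) (i₀ : Fin k), (∀ i, 0 ≤ x i) ∧ (∀ i, x i ≤ x i₀) ∧
      (T : ℚ) * u < x i₀ ∧ x i₀ ≤ (T : ℚ) * (2 * u) ∧
      blockSSE hB (2 * u) x = blockSSE hB u x + ((k : ℚ) - 1) * u ^ 2

open LowPrec.Opt in
/-- R4 (CM-S, Theorem S5 of OPTIMA.md, SSE half): the non-clipping power-of-two scale `2u`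
(`T u < a ≤ 2 T u`) is MINIMAX-optimal among all power-of-two scales `v` for the SSE objective. -/
def R4_CeilMinimaxSSE (B : Finset ℕ) (hB : B.Nonempty) (T : ℕ) : Prop :=
  ∀ (k : ℕ) (x : Fin k → ℚ) (u a : ℚ) (i₀ : Fin k) (v : ℚ), 0 < u → (∀ i, 0 ≤ x i) → (∀ i, x i ≤ a) →
    a ≤ (T : ℚ) * (2 * u) → (T : ℚ) * u < a → x i₀ = a →
    ((∃ n : ℕ, v = 2 ^ n * (2 * u)) ∨ v = u ∨ (∃ n : ℕ, 2 ≤ n ∧ v = 2 * u / 2 ^ n)) →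
      ∃ x' : Fin k → ℚ, (∀ i, 0 ≤ x' i) ∧ (∀ i, x' i ≤ a) ∧ x' i₀ = a ∧
        blockSSE hB (2 * u) x ≤ blockSSE hB v x'

open LowPrec.Opt in
/-- R4 (CM-S, Theorem S4 of OPTIMA.md, block SSE): for block sizes `k ≤ T² + 1` the two candidate
power-of-two scales suffice exactly — with the non-clipping scale `2u` (`T u < a ≤ 2 T u`), every
power-of-two scale `v` (coarser `2^n (2u)`, the half `u`, finer `(2u)/2^n`, `n ≥ 2`) satisfies
`min (SSE(2u), SSE(u)) ≤ SSE(v)`. `T² + 1 = K₂(F)` = 145 (E2M1), 3601 (E2M3), 200705 (E3M2)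
(certificate C2, certs/opt/mxscale_{A,B}.json), 16130 (MXINT8-type uniform grid, certificate C11). PROVED:
`LowPrec.Opt.sse_two_candidates_e2m1/_e2m3/_e3m2` (OptSSEWindow.lean), `LowPrec.Opt.sse_two_candidates_int8` (OptInt8Window.lean). -/
def R4_SSETwoCandidates (B : Finset ℕ) (hB : B.Nonempty) (T : ℕ) : Prop :=
  ∀ (k : ℕ), k ≤ T ^ 2 + 1 → ∀ (x : Fin k → ℚ) (u a : ℚ) (i₀ : Fin k) (v : ℚ), 0 < u →
    (∀ i, 0 ≤ x i) → (∀ i, x i ≤ a) → a ≤ (T : ℚ) * (2 * u) → (T : ℚ) * u < a → x i₀ = a →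
    ((∃ n : ℕ, v = 2 ^ n * (2 * u)) ∨ v = u ∨ (∃ n : ℕ, 2 ≤ n ∧ v = 2 * u / 2 ^ n)) →
      min (blockSSE hB (2 * u) x) (blockSSE hB u x) ≤ blockSSE hB v x

open LowPrec.Opt in
/-- R4 (CM-S, Theorem S4 tightness): for EVERY block size `k ≥ T² + 2` and every `u > 0` there is a
block with maximum in `(T u, 2 T u]` (non-clipping scale `2u`) for which the THIRD scale `u/2` is
strictly better in block SSE than `2u`, than `u`, than every coarser `2^n (2u)` and than every
`u/2^j`, `j ≥ 2` — so the two-candidate threshold `T² + 1` is exact. PROVED: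
`LowPrec.Opt.sse_third_scale_wins_e2m1/_e2m3/_e3m2` (OptSSEWindow.lean; block `(T u + u/(8T), u/2, …, u/2)`),
`LowPrec.Opt.sse_third_scale_wins_int8` (OptInt8Window.lean). -/
def R4_SSEThirdScaleWins (B : Finset ℕ) (hB : B.Nonempty) (T : ℕ) : Prop :=
  ∀ (k : ℕ), T ^ 2 + 2 ≤ k → ∀ (u : ℚ), 0 < u →
    ∃ (x : Fin k → ℚ) (i₀ : Fin k), (∀ i, 0 ≤ x i) ∧ (∀ i, x i ≤ x i₀) ∧
      (T : ℚ) * u < x i₀ ∧ x i₀ ≤ (T : ℚ) * (2 * u) ∧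
      blockSSE hB (u / 2) x < blockSSE hB (2 * u) x ∧
      blockSSE hB (u / 2) x < blockSSE hB u x ∧
      (∀ n : ℕ, blockSSE hB (u / 2) x < blockSSE hB (2 ^ n * (2 * u)) x) ∧
      (∀ j : ℕ, 2 ≤ j → blockSSE hB (u / 2) x < blockSSE hB (u / 2 ^ j) x)

open LowPrec.Opt in
/-- R4 (CM-S, Theorem S9(iii) of OPTIMA.md, L∞, MXINT8-type UNIFORM element grid `int8 = {0,…,127}`):
the minimax statement of Theorem S5 FAILS for the uniform grid and the minimax amax-only power-of-two
rule is the FLOOR rule (switch exactly at the power of two `128 u`): (a) if the maximum satisfies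
`a < 128 u`, EVERY block with entries in `[0, a]` has L∞ error `< u` at the half (clipping) scale `u`;
(b) the two-element block `(a, u)` has L∞ error `≥ u` at the non-clipping scale `2u`; (c) if
`128 u ≤ a ≤ 254 u`, the non-clipping scale is at least as good as the half scale for EVERY block.
PROVED: `LowPrec.Opt.int8_half_blockErr_lt`, `LowPrec.Opt.int8_ceil_blockErr_ge`,
`LowPrec.Opt.int8_ceil_le_half_of_ge` (and the packaged negation `LowPrec.Opt.int8_ceil_not_minimax`)
(OptInt8Minimax.lean). The SSE analogue (irrational switch point) is certificate-only (C11). -/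
def R4_Int8FloorMinimax : Prop :=
  (∀ (k : ℕ) (x : Fin k → ℚ) (u a : ℚ) (i₀ : Fin k), 0 < u → (∀ i, 0 ≤ x i) → (∀ i, x i ≤ a) →
      a < 128 * u → blockErr int8_ne u x i₀ < u) ∧
  (∀ (u a : ℚ), 0 < u → u ≤ blockErr int8_ne (2 * u) ![a, u] 0) ∧
  (∀ (k : ℕ) (x : Fin k → ℚ) (u a : ℚ) (i₀ : Fin k), 0 < u → (∀ i, 0 ≤ x i) → (∀ i, x i ≤ a) →
      a ≤ (127 : ℚ) * (2 * u) → 128 * u ≤ a → x i₀ = a →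
      blockErr int8_ne (2 * u) x i₀ ≤ blockErr int8_ne u x i₀)

/-! ### R2 — compensated and truncated accumulation (appended 2026-08-20 by the lean seat, gen 2) -/

/-- R2 (COMPENSATED recursive summation — Neumaier's Kahan–Babuška variant, the GEMM note's `kbn`):
for summands `x₀ … xₙ ∈ F_α` and no chain sum out of range, the delivered `res = fl(ŝₙ + cₙ)` obeys
`|res - Σxᵢ| ≤ u·|Σxᵢ| + n(n-1)·u²·Σ|xᵢ|` — no condition on `n·u`; implies the classical
`u|s| + γₙ²·Σ|xᵢ|` (`MiniFloat.abs_kbnSum_sub_sum_le_gamma`). PROVED: `MiniFloat.abs_kbnSum_sub_sum_le`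
(CompensatedSum.lean) for every `α` with `emaxCode ≥ 2`, from Fast2Sum being an error-free
transformation under saturation (ErrorFreeAdd.lean, every format) and the Jeannerod–Rump bound
applied to both chains (AccumulateSharp.lean). -/
def R2_CompensatedSum (α : Format) : Prop :=
  ∀ (x : ℕ → ℚ) (n : ℕ), (∀ i ≤ n, ∃ y : MiniFloat α, y.toRat = x i) →
    (∀ k < n, |(kbn α x k).1 + x (k + 1)| ≤ α.maxRat) →
    (∀ k < n, |(kbn α x k).2 + kbnCorr α x k| ≤ α.maxRat) →
    |(kbn α x n).1 + (kbn α x n).2| ≤ α.maxRat →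
      |kbnSum α x n - ∑ i ∈ Finset.range (n + 1), x i|
        ≤ α.unitRoundoff * |∑ i ∈ Finset.range (n + 1), x i|
          + ((n : ℚ) * (n - 1)) * α.unitRoundoff ^ 2 * ∑ i ∈ Finset.range (n + 1), |x i|

/-- R2 (TRUNCATED accumulation, ANY order): every addition rounded toward zero, leaves in `F_α` and
`Σ|xᵢ| ≤ maxRat α` (nothing else): `|ŝ - s| ≤ 2u·(n-1)·Σ|xᵢ|` and `|ŝ - s| ≤ 2u·h·Σ|xᵢ|` (`h` the
height of the evaluation tree) — first order with no higher-order term, every format.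
PROVED: `MiniFloat.abs_eval_rz_sub_exact_le`, `MiniFloat.abs_eval_rz_sub_exact_le_height`
(AccumulateDirected.lean). -/
def R2_TruncatedAnyOrder (α : Format) : Prop :=
  ∀ t : Literature.ComputerArithmetic.JeannerodRump2018.SumTree,
    (∀ x ∈ t.leaves, ∃ y : MiniFloat α, y.toRat = x) → (t.leaves.map abs).sum ≤ α.maxRat →
      |t.eval (fun y => (roundTowardZero α y).toRat) - t.exact|
          ≤ 2 * α.unitRoundoff * ((t.leaves.length : ℚ) - 1) * (t.leaves.map abs).sum ∧
      |t.eval (fun y => (roundTowardZero α y).toRat) - t.exact|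
          ≤ 2 * α.unitRoundoff * (treeHeight t : ℚ) * (t.leaves.map abs).sum

/-- R4 (CM-T, OPTIMA.md T3(a) chain 1): EVERY reduction tree of height `h ≥ 1` has a same-shape relabelling by
`E2M1 × E2M1` products with bfloat16-RNE relative error EXACTLY `(h-1)/(287+h)`. PROVED: `LowPrec.Opt.t3_chain1_ratio`. -/
def R4_TreeChainLowerBound : Prop :=
  ∀ t : Literature.ComputerArithmetic.JeannerodRump2018.SumTree, 1 ≤ treeHeight t → ∃ t', LowPrec.Opt.spike 0 t' =
    LowPrec.Opt.spike 0 t ∧ (∀ x ∈ t'.leaves, x ∈ piE2M1) ∧ |t'.eval (flα Format.BFloat16) - t'.exact| / absLeafSum t' =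
      ((treeHeight t : ℚ) - 1) / (287 + treeHeight t)
end Summit.Ventures.CertifiedArithmetic
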